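import Summits.QuantumFields.YangMills.Theorems.BalabanUVNodesN15BackgroundRelativeForms
import Summits.QuantumFields.YangMills.Theorems.BalabanUVNodesN15BackgroundSiteByName
import HarnessLib

/-!
# Route «BalabanUVNodes» (K4 «SpineRates»), node N15 = NE2 — THE SITE-KERNEL LAYER WITH THE BACKGROUND LIVE, RELATIVE FORM: `T4EtaRate.NE2PlusSite` BY NAME on g3's gauge paired
# instances for the dressed site kernel `[K₀ + P(A′)]⁻¹`, `K₀` an ABSTRACT `U ≡ 1` site form with NE2⁰-TYPE letters (decaying inverse, `K₀W = 1`, η-defect letter — the printed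
# Thm 3.2 (3.48) object's template at `U ≡ 1`), `P(A′)` the dressing words of the piece — the honest repair of S5 (no piece-specific invertibility displayed)

Cell `pub-ymgap`, seat `pub-ymgap-dag-n15-c` (generation g5; R134 ACCELERATION SEAT, strategy s1; HUMAN RULING D-0062; chair R424 venue; `bears_on: R4∕N15`).  Filed
`--supports stmt-QuantumFields-20292 --as helper` (K3⁗; count-neutral).  Imports this seat's R1 `…N15BackgroundRelativeForms` (`hasMaj_idef_dressedSiteRel`, `sAmpRel`) and S5
`…N15BackgroundSiteByName` (`cLin`, `cAmp_le_lin`, `site_thresholds`, and through it S3∕S4 and g4's F14 `vWC_letters_of_gauge`) BY NAME; nothing in the tree is modified.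

WHAT THIS FILE IS (S5 with the `U ≡ 1` site form ABSTRACT).  §2 ★ `hasMaj_idef_vWSiteRelC` (per configuration: the η-defect of the inverses of the RELATIVE site forms
`Ks + (siteForm − siteForm₀)` ∕ `Ks′ + (siteForm′ − siteForm₀′)` is `≤ sAmpRel·θ·e^{−(δ−5σ)d}`).  §3 `vWSiteRelOpsC`, `vWGCSiteRelKernel`, ★★★ **`ne2PlusSite_vWGC_rel`** — `NE2PlusSite 4 p c₃₅`
BY NAME; displayed `U ≡ 1` data: the `U ≡ 1` layer's letters, and for the ABSTRACT site forms `Ks i, Ks′ i`: inverses `Ws i, Ws′ i` with a uniform majorant `β_W·e^{−δd}`, `Ks∘Ws = 1`,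
and the η-defect letter `𝔇(Ks′ i, Ks i) ≤ M₀θ_i·e^{−δd}` (the NE2⁰ site layer's three letters).

HONEST FRAMING ∕ LIMITS.  As S5, with the piece-specific invertibility hypothesis (`(QG²Q*)W_s = 1` for the piece's own `G`) REPLACED by the three NE2⁰-type letters of an abstract
`U ≡ 1` site form; the dressing is the piece's (LINEAR vector single-scale piece ⊗ 1_𝔤 in the sequel, (3.60)-shaped `V′(A′)`, fibrewise-mean transport).  The displayed letters are
HYPOTHESES, not discharged here; Bałaban's `Δ(U)`-side objects are not asserted; NE2⁺ NOT PRINTED, NOT proved; count-neutral (typed 28∕28; discharged count unchanged); N15 NOT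
discharged; one finite T⁴ at fixed ε — NOT infinite volume, NOT OS on ℝ⁴, NOT a mass gap, NOT Clay.
-/

noncomputable section

open scoped BigOperators

namespace Summit.QuantumFields.YangMills.BalabanUVNodes.N15.SiteLayer

open Literature.MathematicalPhysics.QuantumFieldTheory.Balaban1983to89
open Literature.MathematicalPhysics.QuantumFieldTheory.Balaban1983to89.B11SectG (BlockNorm HasMaj RowSum)
open Literature.MathematicalPhysics.QuantumFieldTheory.Balaban1983to89.T4EtaRate (PairedInstance EtaRateIneqSite NE2PlusSite rateFactor)
open Literature.MathematicalPhysics.QuantumFieldTheory.Balaban1983to89.T4EtaRateDefect (idef rateWeight)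
open Literature.MathematicalPhysics.QuantumFieldTheory.Balaban1983to89.T4EtaRateCoeffDefect (pull diagK diagK_mono fibre)
open Literature.MathematicalPhysics.QuantumFieldTheory.Balaban1983to89.B6RandomWalk (Triangle254)
open Literature.MathematicalPhysics.QuantumFieldTheory.Balaban1983to89.B9SectDSup (inv_one_sub_le_two)
open Summit.QuantumFields.YangMills.BalabanUVNodes.N15.OperatorReadout (opGeo opGeo_len)
open Summit.QuantumFields.YangMills.BalabanUVNodes.N15.MatrixSpecies (liftMap liftBlk basisConst basisConst_nonneg)
open Summit.QuantumFields.YangMills.BalabanUVNodes.N15.BackgroundLayer (blkPair liftPair bgConst bgConst_nonneg vWPert vWR gVWc35 le_gVWc35 vWC_letters_of_gauge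
  v1coefC v1coefA v1fieldsOfGauge gavgM v1GaugeBg v1GaugeInstance)

/-! ## §2 Per configuration: the relative dressed site kernels' η-defect with the full perturbation live -/

section Config

variable {X X' Y J ι : Type} [Fintype X] [Fintype X'] [Fintype Y] [Fintype J] [Fintype ι] [DecidableEq X] [DecidableEq X'] [DecidableEq Y] [DecidableEq J]
  [DecidableEq ι] {𝔄 : Type} [NormedRing 𝔄] [NormedAlgebra ℝ 𝔄] [CompleteSpace 𝔄] (e : 𝔄 ≃L[ℝ] (ι → ℝ)) {g : B6.Geometry} (blk : X → g.Site)
  (blkY : Y → g.Site) (q : X × ι → Y) (π : X' → X)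
variable {G : (X × ι → ℝ) →ₗ[ℝ] (X × ι → ℝ)} {D : J ⊕ J → (X × ι → ℝ) →ₗ[ℝ] (X × ι → ℝ)} {G' : (X' × ι → ℝ) →ₗ[ℝ] (X' × ι → ℝ)}
  {D' : J ⊕ J → (X' × ι → ℝ) →ₗ[ℝ] (X' × ι → ℝ)}

/-- **THE η-DEFECT OF THE RELATIVE DRESSED SITE KERNELS WITH THE FULL PERTURBATION LIVE, PER CONFIGURATION** (S5's `hasMaj_idef_vWSiteC` with the `U ≡ 1` site form
ABSTRACT: `Ks, Ks′` with inverses `W_s, W_s′ ≤ β_W·e^{−δd}`, `Ks∘W_s = 1`, `Ks′∘W_s′ = 1`, and the η-defect letter `𝔇(Ks′, Ks) ≤ M₀θ·e^{−δd}`; the relative forms are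
`Ks + (siteForm − siteForm₀)`).  Data of F14's `vWC_letters_of_gauge` (one gauge field `A′` with
(3.35) at `c`, commuting shifts, `C_π`-step-connected fibres, block-translation law, species words `W, W′` at `c_W·(2c′Mα₀)`), guard `2(2c′)a₀ ≤ 1`, `a₀ ≤ 1`,
`β(gVWc35(2c′)a₀)c_r ≤ ½`; the `U ≡ 1` layer `G, D_μ` ∕ `G′, D′_μ` (`β·e^{−δd}`, defects `m₀θ·e^{−δd}`); averaging species `F₂, F₂*, F₂′, F₂*′ ≤ diagK (c_F·(2c′Mα₀))`, fits
`≤ diagK (c_F·(2c′Mα₀)·θ)`; uniform pairing fibres of `liftMap π ι` over the site lattice `Y` (`liftBlk blk ι = blkY ∘ q`); `U ≡ 1` site kernels `W_s, W_s′ ≤ β_W·e^{−δd}`,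
site guard `β_W·cAmp(β, Ka₀, c_r, c_F(2c′)a₀)·c_r² ≤ ½`; `5σ ≤ δ`.  CONCLUSION: `𝔇(D_site′, D_site) ≤ sAmpRel·θ·e^{−(δ−5σ)d}`.
[cite: Balaban1985BackgroundPropagators, (3.65)–(3.67) p.403 (mechanism); Thm 3.2 (3.48) p.398, (3.35) p.396, (3.60) p.402 (shapes)] -/
theorem hasMaj_idef_vWSiteRelC (htri : Triangle254 g) (hd : ∀ a b : g.Site, 0 ≤ g.dist a b) {σ cr : ℝ} (hσ : 0 ≤ σ) (hcr : 0 ≤ cr) (hrow : RowSum g σ cr)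
    {s : J → X ≃ X} {s' : J → X' ≃ X'} {N Nf : ℕ} {δ β m₀ θ c c' a₀ M α₀ η η' Cπ cW cF βW : ℝ} (hσδ : 5 * σ ≤ δ) (hβ : 0 ≤ β) (hm₀ : 0 ≤ m₀) (hθ : 0 ≤ θ)
    (hcomm : ∀ μ κ x, (s' μ).symm (s' κ x) = s' κ ((s' μ).symm x)) (hCπ : 0 ≤ Cπ)
    (hconn : ∀ (f : X' → 𝔄) (b : ℝ), (∀ κ x, ‖f (s' κ x) - f x‖ ≤ b) → ∀ x₁ x₂, π x₁ = π x₂ → ‖f x₁ - f x₂‖ ≤ Cπ * b)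
    (hblk : ∀ μ x', π ((s' μ ^ N) x') = s μ (π x')) (hη' : 0 < η') (hη'η : η' ≤ η) (hη1 : η ≤ 1) (hηθ : η ≤ θ) (hN : η = N * η')
    (hc : 0 ≤ c) (hc'0 : 0 < c') (hcc' : (2 + Fintype.card J) * c ≤ c') (hθ' : (1 + Fintype.card J) * Cπ * (c * M * α₀) * η' ≤ c' * M * α₀ * θ)
    (hM : 1 ≤ M) (hα₀ : 0 < α₀) (hMα : M * α₀ ≤ a₀) (ha₀ : 0 ≤ a₀) (ha₀1 : 2 * (2 * c' * a₀) ≤ 1)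
    (hq : β * (gVWc35 J (basisConst e) (2 * c') cW * a₀) * cr ≤ 1 / 2) (hcW : 0 ≤ cW) (hcF : 0 ≤ cF) (hβW : 0 ≤ βW)
    (hq2 : βW * cAmp β (gVWc35 J (basisConst e) (2 * c') cW * a₀) cr (cF * (2 * c') * a₀) * cr * cr ≤ 1 / 2)
    (hqY : ∀ p, liftBlk blk ι p = blkY (q p)) (hNf : Nf ≠ 0) (hfib : ∀ x, (fibre (liftMap π ι) x).card = Nf)
    (hG : HasMaj (BlockNorm.ofBlocks g (liftBlk blk ι)) (BlockNorm.ofBlocks g (liftBlk blk ι)) G (fun y y' => β * Real.exp (-(δ * g.dist y y'))))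
    (hD : ∀ μ, HasMaj (BlockNorm.ofBlocks g (liftBlk blk ι)) (BlockNorm.ofBlocks g (liftBlk blk ι)) (D μ) (fun y y' => β * Real.exp (-(δ * g.dist y y'))))
    (hG' : HasMaj (BlockNorm.ofBlocks g (liftBlk (blk ∘ π) ι)) (BlockNorm.ofBlocks g (liftBlk (blk ∘ π) ι)) G' (fun y y' => β * Real.exp (-(δ * g.dist y y'))))
    (hD' : ∀ μ, HasMaj (BlockNorm.ofBlocks g (liftBlk (blk ∘ π) ι)) (BlockNorm.ofBlocks g (liftBlk (blk ∘ π) ι)) (D' μ) (fun y y' => β * Real.exp (-(δ * g.dist y y'))))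
    (hDG : HasMaj (BlockNorm.ofBlocks g (liftBlk blk ι)) (BlockNorm.ofBlocks g (liftBlk (blk ∘ π) ι))
      (idef (pull (liftMap π ι)) (pull (liftMap π ι)) G' G) (fun y y' => m₀ * θ * Real.exp (-(δ * g.dist y y'))))
    (hDD : ∀ μ, HasMaj (BlockNorm.ofBlocks g (liftBlk blk ι)) (BlockNorm.ofBlocks g (liftBlk (blk ∘ π) ι))
      (idef (pull (liftMap π ι)) (pull (liftMap π ι)) (D' μ) (D μ)) (fun y y' => m₀ * θ * Real.exp (-(δ * g.dist y y'))))
    {A' : J → X' → 𝔄} (hreg : (v1GaugeBg 𝔄 J s' η' M).Reg335 c α₀ A')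
    {W : (X × ι → ℝ) →ₗ[ℝ] (X × ι → ℝ)} {W' : (X' × ι → ℝ) →ₗ[ℝ] (X' × ι → ℝ)}
    (hW : HasMaj (BlockNorm.ofBlocks g (liftBlk blk ι)) (BlockNorm.ofBlocks g (liftBlk blk ι)) W (diagK fun _ => cW * (2 * c' * M * α₀)))
    (hW' : HasMaj (BlockNorm.ofBlocks g (liftBlk (blk ∘ π) ι)) (BlockNorm.ofBlocks g (liftBlk (blk ∘ π) ι)) W' (diagK fun _ => cW * (2 * c' * M * α₀)))
    (hDW : HasMaj (BlockNorm.ofBlocks g (liftBlk blk ι)) (BlockNorm.ofBlocks g (liftBlk (blk ∘ π) ι))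
      (idef (pull (liftMap π ι)) (pull (liftMap π ι)) W' W) (diagK fun _ => cW * (2 * c' * M * α₀) * θ))
    {F : (X × ι → ℝ) →ₗ[ℝ] (Y → ℝ)} {Fs : (Y → ℝ) →ₗ[ℝ] (X × ι → ℝ)} {F' : (X' × ι → ℝ) →ₗ[ℝ] (Y → ℝ)} {Fs' : (Y → ℝ) →ₗ[ℝ] (X' × ι → ℝ)}
    (hF : HasMaj (BlockNorm.ofBlocks g (liftBlk blk ι)) (BlockNorm.ofBlocks g blkY) F (diagK fun _ => cF * (2 * c' * M * α₀)))
    (hFs : HasMaj (BlockNorm.ofBlocks g blkY) (BlockNorm.ofBlocks g (liftBlk blk ι)) Fs (diagK fun _ => cF * (2 * c' * M * α₀)))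
    (hF' : HasMaj (BlockNorm.ofBlocks g (liftBlk (blk ∘ π) ι)) (BlockNorm.ofBlocks g blkY) F' (diagK fun _ => cF * (2 * c' * M * α₀)))
    (hFs' : HasMaj (BlockNorm.ofBlocks g blkY) (BlockNorm.ofBlocks g (liftBlk (blk ∘ π) ι)) Fs' (diagK fun _ => cF * (2 * c' * M * α₀)))
    (hDF : HasMaj (BlockNorm.ofBlocks g (liftBlk blk ι)) (BlockNorm.ofBlocks g blkY) (idef (pull (liftMap π ι)) LinearMap.id F' F)
      (diagK fun _ => cF * (2 * c' * M * α₀) * θ))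
    (hDFs : HasMaj (BlockNorm.ofBlocks g blkY) (BlockNorm.ofBlocks g (liftBlk (blk ∘ π) ι)) (idef LinearMap.id (pull (liftMap π ι)) Fs' Fs)
      (diagK fun _ => cF * (2 * c' * M * α₀) * θ))
    {Ws Ws' Ks Ks' : (Y → ℝ) →ₗ[ℝ] (Y → ℝ)} {M₀ : ℝ} (hM₀ : 0 ≤ M₀)
    (hWs : HasMaj (BlockNorm.ofBlocks g blkY) (BlockNorm.ofBlocks g blkY) Ws (fun y y' => βW * Real.exp (-(δ * g.dist y y'))))
    (hWs' : HasMaj (BlockNorm.ofBlocks g blkY) (BlockNorm.ofBlocks g blkY) Ws' (fun y y' => βW * Real.exp (-(δ * g.dist y y'))))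
    (hKW : Ks ∘ₗ Ws = LinearMap.id) (hKW' : Ks' ∘ₗ Ws' = LinearMap.id)
    (hDKs : HasMaj (BlockNorm.ofBlocks g blkY) (BlockNorm.ofBlocks g blkY) (idef LinearMap.id LinearMap.id Ks' Ks) (fun y y' => M₀ * θ * Real.exp (-(δ * g.dist y y')))) :
    HasMaj (BlockNorm.ofBlocks g blkY) (BlockNorm.ofBlocks g blkY)
      (idef LinearMap.id LinearMap.id
        (siteInv Ws' Ks' (Ks' + (siteForm (q ∘ liftMap π ι) F' Fs'
          (dressedOp G' D' (vWPert (v1coefC e η' (v1fieldsOfGauge 𝔄 J s' η' A')) (v1coefA e η' (v1fieldsOfGauge 𝔄 J s' η' A')) W')) -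
          siteForm₀ (q ∘ liftMap π ι) G')))
        (siteInv Ws Ks (Ks + (siteForm q F Fs
          (dressedOp G D (vWPert (v1coefC e η (v1fieldsOfGauge 𝔄 J s η (gavgM 𝔄 J π A'))) (v1coefA e η (v1fieldsOfGauge 𝔄 J s η (gavgM 𝔄 J π A'))) W)) -
          siteForm₀ q G))))
      (fun y y' => sAmpRel β (gVWc35 J (basisConst e) (2 * c') cW * a₀) cr (cF * (2 * c') * a₀) m₀ (gVWc35 J (basisConst e) (2 * c') cW) a₀
        (cF * (2 * c') * a₀) βW M₀ * θ * Real.exp (-((δ - 5 * σ) * g.dist y y'))) := by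
  obtain ⟨hR0, hRa, hV, hV', hDV⟩ :=
    vWC_letters_of_gauge e (g := g) blk π hcomm hCπ hconn hblk hη' hη'η hη1 hηθ hN hc hc'0 hcc' hθ' hM hα₀ hMα ha₀1 hcW hreg hW hW' hDW
  set K : ℝ := gVWc35 J (basisConst e) (2 * c') cW with hKdef
  have hK : 0 ≤ K := (le_gVWc35 (J := J) (basisConst_nonneg e) (by positivity : 0 < 2 * c') hcW).2.1.le
  have hθ0 : 0 ≤ θ := hθ
  have hV₁ := hV.mono fun y y' => diagK_mono (fun _ => hRa) y y'
  have hV₁' := hV'.mono fun y y' => diagK_mono (fun _ => hRa) y y'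
  have hDV₁ := hDV.mono fun y y' => diagK_mono (fun _ => mul_le_mul_of_nonneg_right hRa hθ0) y y'
  have hr : cF * (2 * c' * M * α₀) ≤ cF * (2 * c') * a₀ := by
    have : 2 * c' * M * α₀ = 2 * c' * (M * α₀) := by ring
    rw [this, mul_assoc cF]
    exact mul_le_mul_of_nonneg_left (mul_le_mul_of_nonneg_left hMα (by positivity)) hcF
  have hr0 : 0 ≤ cF * (2 * c') * a₀ := by positivity
  have hF₁ := hF.mono fun y y' => diagK_mono (fun _ => hr) y y'
  have hFs₁ := hFs.mono fun y y' => diagK_mono (fun _ => hr) y y'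
  have hF₁' := hF'.mono fun y y' => diagK_mono (fun _ => hr) y y'
  have hFs₁' := hFs'.mono fun y y' => diagK_mono (fun _ => hr) y y'
  have hDF₁ := hDF.mono fun y y' => diagK_mono (fun _ => mul_le_mul_of_nonneg_right hr hθ0) y y'
  have hDFs₁ := hDFs.mono fun y y' => diagK_mono (fun _ => mul_le_mul_of_nonneg_right hr hθ0) y y'
  exact hasMaj_idef_dressedSiteRel htri hd hrow hσ hcr (liftBlk blk ι) blkY q (liftMap π ι) hqY hNf hfib hσδ hβ hm₀ hθ hK ha₀ hq (mul_nonneg hK ha₀) le_rfl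
    hr0 hr0 hβW hM₀ hq2 hG hD hG' hD' hDG hDD hV₁ hV₁' hDV₁ hF₁ hFs₁ hF₁' hFs₁' hDF₁ hDFs₁ hWs hWs' hKW hKW' hDKs

end Config

/-! ## §3 The relative site-kernel family on the gauge paired instances, and the node's second conjunct BY NAME -/

section Node

variable {I J ι : Type} [Fintype J] [DecidableEq J] [Fintype ι] [DecidableEq ι] {𝔄 : Type} [NormedRing 𝔄] [NormedAlgebra ℝ 𝔄] [CompleteSpace 𝔄]
  (e : 𝔄 ≃L[ℝ] (ι → ℝ)) (g : I → B6.Geometry) (X X' Y : I → Type) [∀ i, Fintype (X i)] [∀ i, Fintype (X' i)] [∀ i, Fintype (Y i)] [∀ i, DecidableEq (X i)]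
  [∀ i, DecidableEq (X' i)] [∀ i, DecidableEq (Y i)] (blk : ∀ i, X i → (g i).Site) (blkY : ∀ i, Y i → (g i).Site) (q : ∀ i, X i × ι → Y i)
  (π : ∀ i, X' i → X i) (nsh : I → ℕ) (hL0 : ∀ i, (g i).L ≠ 0) (θ : I → ℝ)
  (G : ∀ i, (X i × ι → ℝ) →ₗ[ℝ] (X i × ι → ℝ)) (D : ∀ i, J ⊕ J → (X i × ι → ℝ) →ₗ[ℝ] (X i × ι → ℝ))
  (G' : ∀ i, (X' i × ι → ℝ) →ₗ[ℝ] (X' i × ι → ℝ)) (D' : ∀ i, J ⊕ J → (X' i × ι → ℝ) →ₗ[ℝ] (X' i × ι → ℝ))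
  (s : ∀ i, J → X i ≃ X i) (s' : ∀ i, J → X' i ≃ X' i) (Cπ : I → ℝ) (Nst Nf : I → ℕ)
  (Wc : ∀ i, (J → X' i → 𝔄) → ((X i × ι → ℝ) →ₗ[ℝ] (X i × ι → ℝ))) (Wf : ∀ i, (J → X' i → 𝔄) → ((X' i × ι → ℝ) →ₗ[ℝ] (X' i × ι → ℝ)))
  (Fc : ∀ i, (J → X' i → 𝔄) → ((X i × ι → ℝ) →ₗ[ℝ] (Y i → ℝ))) (Fsc : ∀ i, (J → X' i → 𝔄) → ((Y i → ℝ) →ₗ[ℝ] (X i × ι → ℝ)))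
  (Ff : ∀ i, (J → X' i → 𝔄) → ((X' i × ι → ℝ) →ₗ[ℝ] (Y i → ℝ))) (Fsf : ∀ i, (J → X' i → 𝔄) → ((Y i → ℝ) →ₗ[ℝ] (X' i × ι → ℝ)))
  (Ws Ws' Ks Ks' : ∀ i, (Y i → ℝ) →ₗ[ℝ] (Y i → ℝ))

/-- THE RELATIVE SITE-LAYER OPS at a fine gauge field `A′` of instance `i` (S5's `vWSiteOpsC` with the `U ≡ 1` site forms `Ks i, Ks′ i` ABSTRACT): the η-difference (common site lattice, identity transports) of the fine dressed site kernel at `A′`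
(spacing `η′_i = η_i(L^{n_i})⁻¹`, `V′₁` coefficients at the fine triple, word `Wf i A′`, species `Ff i A′`, `Fsf i A′`, `U ≡ 1` site kernel `Ws′ i`) and the coarse one at
the mean field's triple (`η_i`, `Wc i A′`, `Fc i A′`, `Fsc i A′`, `Ws i`). [cite: Balaban1985BackgroundPropagators, (3.65)–(3.67) p.403 (shape)] -/
def vWSiteRelOpsC (i : I) : (J → X' i → 𝔄) → ((Y i → ℝ) →ₗ[ℝ] (Y i → ℝ)) := fun A' =>
  idef LinearMap.id LinearMap.id
    (siteInv (Ws' i) (Ks' i) (Ks' i + (siteForm (q i ∘ liftMap (π i) ι) (Ff i A') (Fsf i A')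
      (dressedOp (G' i) (D' i) (vWPert (v1coefC e ((g i).eta * ((g i).L ^ nsh i)⁻¹) (v1fieldsOfGauge 𝔄 J (s' i) ((g i).eta * ((g i).L ^ nsh i)⁻¹) A'))
        (v1coefA e ((g i).eta * ((g i).L ^ nsh i)⁻¹) (v1fieldsOfGauge 𝔄 J (s' i) ((g i).eta * ((g i).L ^ nsh i)⁻¹) A')) (Wf i A'))) -
      siteForm₀ (q i ∘ liftMap (π i) ι) (G' i))))
    (siteInv (Ws i) (Ks i) (Ks i + (siteForm (q i) (Fc i A') (Fsc i A')
      (dressedOp (G i) (D i) (vWPert (v1coefC e (g i).eta (v1fieldsOfGauge 𝔄 J (s i) (g i).eta (gavgM 𝔄 J (π i) A')))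
        (v1coefA e (g i).eta (v1fieldsOfGauge 𝔄 J (s i) (g i).eta (gavgM 𝔄 J (π i) A'))) (Wc i A'))) -
      siteForm₀ (q i) (G i))))

/-- THE RELATIVE SITE-KERNEL FAMILY on g3's gauge paired instances: `siteKernelOf` of `vWSiteRelOpsC`. [cite: Balaban1985BackgroundPropagators, Thm 3.2 (3.48) p.398 (shape)] -/
def vWGCSiteRelKernel (i : I) :
    B9.SiteKernel (v1GaugeInstance 𝔄 J ι (blk i) (π i) (s i) (s' i) (nsh i) (hL0 i)).gc (v1GaugeInstance 𝔄 J ι (blk i) (π i) (s i) (s' i) (nsh i) (hL0 i)).Bf :=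
  show B9.SiteKernel (opGeo (g i) (X i × ι) (liftBlk (blk i) ι)) (v1GaugeBg 𝔄 J (s' i) ((g i).eta * ((g i).L ^ nsh i)⁻¹) (g i).M) from
    siteKernelOf (liftBlk (blk i) ι) (blkY i) (vWSiteRelOpsC e g X X' Y q π nsh G D G' D' s s' Wc Wf Fc Fsc Ff Fsf Ws Ws' Ks Ks' i)

/-- **NE2⁺, SITE-KERNEL LAYER, RELATIVE FORM — `T4EtaRate.NE2PlusSite 4 p c₃₅` BY NAME, (3.60)-SHAPED FULL PERTURBATION LIVE, GAUGE FIELD THE DATUM** — S5's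
`ne2PlusSite_vWGC` with the `U ≡ 1` site forms `Ks i, Ks′ i` ABSTRACT (inverses `Ws i, Ws′ i` with a uniform majorant `β_W·e^{−δd}`, `Ks∘Ws = 1`, `Ks′∘Ws′ = 1`, η-defect letter
`𝔇(Ks′ i, Ks i) ≤ M₀θ_i·e^{−δd}` — the NE2⁰ site layer's three letters, HYPOTHESES here); on the SAME gauge paired
instances as F15's `ne2PlusOperator_vWGC` and with the same structural hypotheses ([B6] carriers, uniform (2.61), the `U ≡ 1` layer `G, D_μ` with uniform letters,
commuting unit shifts, `C_π(i)`-step-connected fibres with `C_π(i)η′_i ≤ C₀θ_i`, block-translation law, word species `Wc i A′`, `Wf i A′` with (3.35)-letters in the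
regime `2c₃₅M_iα₀ ≤ 1`), PLUS: averaging species `Fc, Fsc, Ff, Fsf` with block-local letters `≤ diagK (c_F·c₃₅M_iα₀)` and fits `≤ diagK (c_F·c₃₅M_iα₀·θ_i)` in the same
regime, uniform pairing fibres over the site lattices `Y i` (`liftBlk (blk i) ι = blkY i ∘ q i`), unit-scale sites (`len ≡ 1`), and the `U ≡ 1` SITE KERNELS `Ws i, Ws′ i`
with a uniform majorant `β_W·e^{−δd}` inverting the ABSTRACT forms `Ks i` ∕ `Ks′ i` — then `NE2PlusSite 4 p c₃₅ pi (vWGCSiteRelKernel …)` for every `p` (inside: `M₅ = 1`,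
`δ_site = δ − 5σ`, `a₀ = min a₁ a₂`, `C = sAmpRel + 1`).  NOT PRINTED (no η-rate is); N15's second conjunct for a background-live family, relative form.
[cite: Balaban1985BackgroundPropagators, Thm 3.2 (3.48) p.398 + Thm 3.14 pp.426–427 (quantifier template); (3.35) p.396, (3.60) p.402, (3.65)–(3.67) p.403 (shapes, mechanism)] -/
theorem ne2PlusSite_vWGC_rel (c35 : ℝ) (hc35 : 0 < c35) (p : ℝ) {M₀ : ℝ} (hM₀ : 0 ≤ M₀)
    (htri : ∀ i, Triangle254 (g i)) (hd : ∀ i (a b : (g i).Site), 0 ≤ (g i).dist a b) {σ cr : ℝ} (hσ : 0 ≤ σ) (hcr : 0 ≤ cr)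
    (hrow : ∀ i, RowSum (g i) σ cr) (hη : ∀ i, 0 < (g i).eta) (hη1 : ∀ i, (g i).eta ≤ 1) (hηθ : ∀ i, (g i).eta ≤ θ i) (hL : ∀ i, 1 ≤ (g i).L)
    (hlen : ∀ i y, (g i).len y = 1) {δ β m₀ γ cW cF βW : ℝ} (hσδ : 5 * σ < δ) (hβ : 0 ≤ β) (hm₀ : 0 ≤ m₀) (hγ : 0 < γ)
    (hθγ : ∀ i y, θ i ≤ rateWeight (g i) γ y)
    (hcomm : ∀ i μ κ x, (s' i μ).symm (s' i κ x) = s' i κ ((s' i μ).symm x)) (hCπ : ∀ i, 0 ≤ Cπ i)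
    (hconn : ∀ i (f : X' i → 𝔄) (b : ℝ), (∀ κ x, ‖f (s' i κ x) - f x‖ ≤ b) → ∀ x₁ x₂, π i x₁ = π i x₂ → ‖f x₁ - f x₂‖ ≤ Cπ i * b)
    {C₀ : ℝ} (hC₀ : 0 ≤ C₀) (hCθ : ∀ i, Cπ i * ((g i).eta * ((g i).L ^ nsh i)⁻¹) ≤ C₀ * θ i) (hcW : 0 ≤ cW) (hcF : 0 ≤ cF) (hβW : 0 ≤ βW)
    (hblk : ∀ i μ x', π i ((s' i μ ^ Nst i) x') = s i μ (π i x')) (hN : ∀ i, (g i).eta = Nst i * ((g i).eta * ((g i).L ^ nsh i)⁻¹))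
    (hqY : ∀ i pt, liftBlk (blk i) ι pt = blkY i (q i pt)) (hNf : ∀ i, Nf i ≠ 0) (hfib : ∀ i x, (fibre (liftMap (π i) ι) x).card = Nf i)
    (hWc : ∀ i (α₀ : ℝ) A', 0 < α₀ → 2 * (c35 * ((g i).M * α₀)) ≤ 1 → (v1GaugeBg 𝔄 J (s' i) ((g i).eta * ((g i).L ^ nsh i)⁻¹) (g i).M).Reg335 c35 α₀ A' →
      HasMaj (BlockNorm.ofBlocks (g i) (liftBlk (blk i) ι)) (BlockNorm.ofBlocks (g i) (liftBlk (blk i) ι)) (Wc i A') (diagK fun _ => cW * (c35 * (g i).M * α₀)))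
    (hWf : ∀ i (α₀ : ℝ) A', 0 < α₀ → 2 * (c35 * ((g i).M * α₀)) ≤ 1 → (v1GaugeBg 𝔄 J (s' i) ((g i).eta * ((g i).L ^ nsh i)⁻¹) (g i).M).Reg335 c35 α₀ A' →
      HasMaj (BlockNorm.ofBlocks (g i) (liftBlk (blk i ∘ π i) ι)) (BlockNorm.ofBlocks (g i) (liftBlk (blk i ∘ π i) ι)) (Wf i A')
        (diagK fun _ => cW * (c35 * (g i).M * α₀)))
    (hDW : ∀ i (α₀ : ℝ) A', 0 < α₀ → 2 * (c35 * ((g i).M * α₀)) ≤ 1 → (v1GaugeBg 𝔄 J (s' i) ((g i).eta * ((g i).L ^ nsh i)⁻¹) (g i).M).Reg335 c35 α₀ A' →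
      HasMaj (BlockNorm.ofBlocks (g i) (liftBlk (blk i) ι)) (BlockNorm.ofBlocks (g i) (liftBlk (blk i ∘ π i) ι))
        (idef (pull (liftMap (π i) ι)) (pull (liftMap (π i) ι)) (Wf i A') (Wc i A')) (diagK fun _ => cW * (c35 * (g i).M * α₀) * θ i))
    (hFc : ∀ i (α₀ : ℝ) A', 0 < α₀ → 2 * (c35 * ((g i).M * α₀)) ≤ 1 → (v1GaugeBg 𝔄 J (s' i) ((g i).eta * ((g i).L ^ nsh i)⁻¹) (g i).M).Reg335 c35 α₀ A' →
      HasMaj (BlockNorm.ofBlocks (g i) (liftBlk (blk i) ι)) (BlockNorm.ofBlocks (g i) (blkY i)) (Fc i A') (diagK fun _ => cF * (c35 * (g i).M * α₀)))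
    (hFsc : ∀ i (α₀ : ℝ) A', 0 < α₀ → 2 * (c35 * ((g i).M * α₀)) ≤ 1 → (v1GaugeBg 𝔄 J (s' i) ((g i).eta * ((g i).L ^ nsh i)⁻¹) (g i).M).Reg335 c35 α₀ A' →
      HasMaj (BlockNorm.ofBlocks (g i) (blkY i)) (BlockNorm.ofBlocks (g i) (liftBlk (blk i) ι)) (Fsc i A') (diagK fun _ => cF * (c35 * (g i).M * α₀)))
    (hFf : ∀ i (α₀ : ℝ) A', 0 < α₀ → 2 * (c35 * ((g i).M * α₀)) ≤ 1 → (v1GaugeBg 𝔄 J (s' i) ((g i).eta * ((g i).L ^ nsh i)⁻¹) (g i).M).Reg335 c35 α₀ A' →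
      HasMaj (BlockNorm.ofBlocks (g i) (liftBlk (blk i ∘ π i) ι)) (BlockNorm.ofBlocks (g i) (blkY i)) (Ff i A') (diagK fun _ => cF * (c35 * (g i).M * α₀)))
    (hFsf : ∀ i (α₀ : ℝ) A', 0 < α₀ → 2 * (c35 * ((g i).M * α₀)) ≤ 1 → (v1GaugeBg 𝔄 J (s' i) ((g i).eta * ((g i).L ^ nsh i)⁻¹) (g i).M).Reg335 c35 α₀ A' →
      HasMaj (BlockNorm.ofBlocks (g i) (blkY i)) (BlockNorm.ofBlocks (g i) (liftBlk (blk i ∘ π i) ι)) (Fsf i A') (diagK fun _ => cF * (c35 * (g i).M * α₀)))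
    (hDF : ∀ i (α₀ : ℝ) A', 0 < α₀ → 2 * (c35 * ((g i).M * α₀)) ≤ 1 → (v1GaugeBg 𝔄 J (s' i) ((g i).eta * ((g i).L ^ nsh i)⁻¹) (g i).M).Reg335 c35 α₀ A' →
      HasMaj (BlockNorm.ofBlocks (g i) (liftBlk (blk i) ι)) (BlockNorm.ofBlocks (g i) (blkY i))
        (idef (pull (liftMap (π i) ι)) LinearMap.id (Ff i A') (Fc i A')) (diagK fun _ => cF * (c35 * (g i).M * α₀) * θ i))
    (hDFs : ∀ i (α₀ : ℝ) A', 0 < α₀ → 2 * (c35 * ((g i).M * α₀)) ≤ 1 → (v1GaugeBg 𝔄 J (s' i) ((g i).eta * ((g i).L ^ nsh i)⁻¹) (g i).M).Reg335 c35 α₀ A' →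
      HasMaj (BlockNorm.ofBlocks (g i) (blkY i)) (BlockNorm.ofBlocks (g i) (liftBlk (blk i ∘ π i) ι))
        (idef LinearMap.id (pull (liftMap (π i) ι)) (Fsf i A') (Fsc i A')) (diagK fun _ => cF * (c35 * (g i).M * α₀) * θ i))
    (hG : ∀ i, HasMaj (BlockNorm.ofBlocks (g i) (liftBlk (blk i) ι)) (BlockNorm.ofBlocks (g i) (liftBlk (blk i) ι)) (G i)
      (fun y y' => β * Real.exp (-(δ * (g i).dist y y'))))
    (hD : ∀ i μ, HasMaj (BlockNorm.ofBlocks (g i) (liftBlk (blk i) ι)) (BlockNorm.ofBlocks (g i) (liftBlk (blk i) ι)) (D i μ)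
      (fun y y' => β * Real.exp (-(δ * (g i).dist y y'))))
    (hG' : ∀ i, HasMaj (BlockNorm.ofBlocks (g i) (liftBlk (blk i ∘ π i) ι)) (BlockNorm.ofBlocks (g i) (liftBlk (blk i ∘ π i) ι)) (G' i)
      (fun y y' => β * Real.exp (-(δ * (g i).dist y y'))))
    (hD' : ∀ i μ, HasMaj (BlockNorm.ofBlocks (g i) (liftBlk (blk i ∘ π i) ι)) (BlockNorm.ofBlocks (g i) (liftBlk (blk i ∘ π i) ι)) (D' i μ)
      (fun y y' => β * Real.exp (-(δ * (g i).dist y y'))))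
    (hDG : ∀ i, HasMaj (BlockNorm.ofBlocks (g i) (liftBlk (blk i) ι)) (BlockNorm.ofBlocks (g i) (liftBlk (blk i ∘ π i) ι))
      (idef (pull (liftMap (π i) ι)) (pull (liftMap (π i) ι)) (G' i) (G i)) (fun y y' => m₀ * θ i * Real.exp (-(δ * (g i).dist y y'))))
    (hDD : ∀ i μ, HasMaj (BlockNorm.ofBlocks (g i) (liftBlk (blk i) ι)) (BlockNorm.ofBlocks (g i) (liftBlk (blk i ∘ π i) ι))
      (idef (pull (liftMap (π i) ι)) (pull (liftMap (π i) ι)) (D' i μ) (D i μ)) (fun y y' => m₀ * θ i * Real.exp (-(δ * (g i).dist y y'))))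
    (hWs : ∀ i, HasMaj (BlockNorm.ofBlocks (g i) (blkY i)) (BlockNorm.ofBlocks (g i) (blkY i)) (Ws i) (fun y y' => βW * Real.exp (-(δ * (g i).dist y y'))))
    (hWs' : ∀ i, HasMaj (BlockNorm.ofBlocks (g i) (blkY i)) (BlockNorm.ofBlocks (g i) (blkY i)) (Ws' i) (fun y y' => βW * Real.exp (-(δ * (g i).dist y y'))))
    (hKW : ∀ i, Ks i ∘ₗ Ws i = LinearMap.id) (hKW' : ∀ i, Ks' i ∘ₗ Ws' i = LinearMap.id)
    (hDKs : ∀ i, HasMaj (BlockNorm.ofBlocks (g i) (blkY i)) (BlockNorm.ofBlocks (g i) (blkY i)) (idef LinearMap.id LinearMap.id (Ks' i) (Ks i))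
      (fun y y' => M₀ * θ i * Real.exp (-(δ * (g i).dist y y')))) :
    NE2PlusSite 4 p c35 (fun i => v1GaugeInstance 𝔄 J ι (blk i) (π i) (s i) (s' i) (nsh i) (hL0 i))
      (vWGCSiteRelKernel e g X X' Y blk blkY q π nsh hL0 G D G' D' s s' Wc Wf Fc Fsc Ff Fsf Ws Ws' Ks Ks') := by
  have hJ0 : (0 : ℝ) ≤ Fintype.card J := Nat.cast_nonneg _
  set c' : ℝ := (2 + Fintype.card J) * (1 + C₀) * c35 with hc'
  have hc'pos : 0 < c' := by positivity
  have hc35c' : c35 ≤ 2 * c' := by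
    rw [hc']
    have h1 : (1 : ℝ) ≤ 2 * ((2 + Fintype.card J) * (1 + C₀)) := by nlinarith [mul_nonneg hJ0 hC₀]
    nlinarith
  have h2c'pos : 0 < 2 * c' := by positivity
  obtain ⟨hcg, hgpos, _⟩ := le_gVWc35 (J := J) (basisConst_nonneg e) h2c'pos hcW
  have hP : 0 ≤ cLin β (gVWc35 J (basisConst e) (2 * c') cW) cr (cF * (2 * c')) := cLin_nonneg hβ hgpos.le hcr (by positivity)
  obtain ⟨a₀, ha₀, ha₀le, hq, ha₀1, hq2P⟩ := site_thresholds hβ hcr hgpos hcg hc'pos hP hβW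
  have hq2 : βW * cAmp β (gVWc35 J (basisConst e) (2 * c') cW * a₀) cr (cF * (2 * c') * a₀) * cr * cr ≤ 1 / 2 := by
    have hle := cAmp_le_lin (β := β) (K := gVWc35 J (basisConst e) (2 * c') cW) (cr := cr) (rK := cF * (2 * c')) hβ hgpos.le hcr (by positivity)
      ha₀.le ha₀le hq
    have h1 : βW * cAmp β (gVWc35 J (basisConst e) (2 * c') cW * a₀) cr (cF * (2 * c') * a₀) * cr * cr ≤
        βW * (a₀ * cLin β (gVWc35 J (basisConst e) (2 * c') cW) cr (cF * (2 * c'))) * cr * cr :=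
      mul_le_mul_of_nonneg_right (mul_le_mul_of_nonneg_right (mul_le_mul_of_nonneg_left hle hβW) hcr) hcr
    exact h1.trans hq2P
  have hqlt : β * (gVWc35 J (basisConst e) (2 * c') cW * a₀) * cr < 1 := by linarith
  have hq2lt : βW * cAmp β (gVWc35 J (basisConst e) (2 * c') cW * a₀) cr (cF * (2 * c') * a₀) * cr * cr < 1 := by linarith
  have hC : 0 ≤ sAmpRel β (gVWc35 J (basisConst e) (2 * c') cW * a₀) cr (cF * (2 * c') * a₀) m₀ (gVWc35 J (basisConst e) (2 * c') cW) a₀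
      (cF * (2 * c') * a₀) βW M₀ := sAmpRel_nonneg hβ hcr (by positivity) hm₀ hgpos.le ha₀.le (by positivity) hβW hM₀ hqlt hq2lt
  generalize hCdef : sAmpRel β (gVWc35 J (basisConst e) (2 * c') cW * a₀) cr (cF * (2 * c') * a₀) m₀ (gVWc35 J (basisConst e) (2 * c') cW) a₀
      (cF * (2 * c') * a₀) βW M₀ = C at hC
  refine ⟨1, δ - 5 * σ, a₀, C + 1, γ, one_pos, by linarith, ha₀, by linarith, hγ, fun i hM α₀ hα₀ hMα A' hreg => ?_⟩
  have hM' : 1 ≤ (g i).M := hM; have hMα' : (g i).M * α₀ ≤ a₀ := hMα; have hM0 : 0 ≤ (g i).M := zero_le_one.trans hM'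
  have hLpos : 0 < (g i).L := lt_of_lt_of_le one_pos (hL i)
  have hη'pos : 0 < (g i).eta * ((g i).L ^ nsh i)⁻¹ := mul_pos (hη i) (inv_pos.2 (pow_pos hLpos _))
  have hη'η : (g i).eta * ((g i).L ^ nsh i)⁻¹ ≤ (g i).eta := by
    have h1 : ((g i).L ^ nsh i)⁻¹ ≤ 1 := inv_le_one_of_one_le₀ (one_le_pow₀ (hL i))
    calc (g i).eta * ((g i).L ^ nsh i)⁻¹ ≤ (g i).eta * 1 := mul_le_mul_of_nonneg_left h1 (hη i).le
      _ = (g i).eta := mul_one _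
  have hθ0 : 0 ≤ θ i := (hη i).le.trans (hηθ i)
  have hcc' : (2 + Fintype.card J) * c35 ≤ c' := by
    rw [hc']
    have h0 : 0 ≤ (2 + Fintype.card J) * c35 := by positivity
    nlinarith [mul_nonneg hC₀ h0]
  have hθ' : (1 + Fintype.card J) * Cπ i * (c35 * (g i).M * α₀) * ((g i).eta * ((g i).L ^ nsh i)⁻¹) ≤ c' * (g i).M * α₀ * θ i := by
    have h0 : 0 ≤ (1 + Fintype.card J) * (c35 * (g i).M * α₀) := by positivity
    have hMα0 : 0 ≤ (g i).M * α₀ := mul_nonneg hM0 hα₀.le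
    have hcoef : (1 + Fintype.card J) * C₀ * c35 ≤ c' := by
      rw [hc']; nlinarith [mul_nonneg hC₀ hJ0, hc35.le, mul_nonneg (mul_nonneg hC₀ hJ0) hc35.le, mul_nonneg hJ0 hc35.le, mul_nonneg hC₀ hc35.le]
    calc (1 + Fintype.card J) * Cπ i * (c35 * (g i).M * α₀) * ((g i).eta * ((g i).L ^ nsh i)⁻¹)
        = (1 + Fintype.card J) * (c35 * (g i).M * α₀) * (Cπ i * ((g i).eta * ((g i).L ^ nsh i)⁻¹)) := by ring
      _ ≤ (1 + Fintype.card J) * (c35 * (g i).M * α₀) * (C₀ * θ i) := mul_le_mul_of_nonneg_left (hCθ i) h0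
      _ = ((1 + Fintype.card J) * C₀ * c35) * ((g i).M * α₀) * θ i := by ring
      _ ≤ c' * ((g i).M * α₀) * θ i := mul_le_mul_of_nonneg_right (mul_le_mul_of_nonneg_right hcoef hMα0) hθ0
      _ = c' * (g i).M * α₀ * θ i := by ring
  have hregA : (v1GaugeBg 𝔄 J (s' i) ((g i).eta * ((g i).L ^ nsh i)⁻¹) (g i).M).Reg335 c35 α₀ A' := hreg
  have hmono : c35 * (g i).M * α₀ ≤ 2 * c' * (g i).M * α₀ := mul_le_mul_of_nonneg_right (mul_le_mul_of_nonneg_right hc35c' hM0) hα₀.le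
  have hmW : cW * (c35 * (g i).M * α₀) ≤ cW * (2 * c' * (g i).M * α₀) := mul_le_mul_of_nonneg_left hmono hcW
  have hmF : cF * (c35 * (g i).M * α₀) ≤ cF * (2 * c' * (g i).M * α₀) := mul_le_mul_of_nonneg_left hmono hcF
  have hsm : 2 * (c35 * ((g i).M * α₀)) ≤ 1 :=
    (mul_le_mul_of_nonneg_left ((mul_le_mul_of_nonneg_left hMα' hc35.le).trans (mul_le_mul_of_nonneg_right hc35c' ha₀.le)) zero_le_two).trans ha₀1
  have hWc' := (hWc i α₀ A' hα₀ hsm hregA).mono fun y y' => diagK_mono (fun _ => hmW) y y'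
  have hWf' := (hWf i α₀ A' hα₀ hsm hregA).mono fun y y' => diagK_mono (fun _ => hmW) y y'
  have hDW' := (hDW i α₀ A' hα₀ hsm hregA).mono fun y y' => diagK_mono (fun _ => mul_le_mul_of_nonneg_right hmW hθ0) y y'
  have hFc' := (hFc i α₀ A' hα₀ hsm hregA).mono fun y y' => diagK_mono (fun _ => hmF) y y'
  have hFsc' := (hFsc i α₀ A' hα₀ hsm hregA).mono fun y y' => diagK_mono (fun _ => hmF) y y'
  have hFf' := (hFf i α₀ A' hα₀ hsm hregA).mono fun y y' => diagK_mono (fun _ => hmF) y y'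
  have hFsf' := (hFsf i α₀ A' hα₀ hsm hregA).mono fun y y' => diagK_mono (fun _ => hmF) y y'
  have hDF' := (hDF i α₀ A' hα₀ hsm hregA).mono fun y y' => diagK_mono (fun _ => mul_le_mul_of_nonneg_right hmF hθ0) y y'
  have hDFs' := (hDFs i α₀ A' hα₀ hsm hregA).mono fun y y' => diagK_mono (fun _ => mul_le_mul_of_nonneg_right hmF hθ0) y y'
  have key := hasMaj_idef_vWSiteRelC e (blk i) (blkY i) (q i) (π i) (htri i) (hd i) hσ hcr (hrow i) hσδ.le hβ hm₀ hθ0 (hcomm i) (hCπ i) (hconn i) (hblk i)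
    hη'pos hη'η (hη1 i) (hηθ i) (hN i) hc35.le hc'pos hcc' hθ' hM' hα₀ hMα' ha₀.le ha₀1 hq hcW hcF hβW hq2 (hqY i) (hNf i) (hfib i) (hG i) (hD i) (hG' i)
    (hD' i) (hDG i) (hDD i) hregA hWc' hWf' hDW' hFc' hFsc' hFf' hFsf' hDF' hDFs' hM₀ (hWs i) (hWs' i) (hKW i) (hKW' i) (hDKs i)
  rw [hCdef] at key
  have key' : HasMaj (BlockNorm.ofBlocks (g i) (blkY i)) (BlockNorm.ofBlocks (g i) (blkY i))
      (vWSiteRelOpsC e g X X' Y q π nsh G D G' D' s s' Wc Wf Fc Fsc Ff Fsf Ws Ws' Ks Ks' i A')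
      (fun y y' => C * Real.exp (-((δ - 5 * σ) * (g i).dist y y')) * rateWeight (g i) γ y') := by
    refine key.mono fun y y' => ?_
    calc C * θ i * Real.exp (-((δ - 5 * σ) * (g i).dist y y'))
        = C * Real.exp (-((δ - 5 * σ) * (g i).dist y y')) * θ i := by ring
      _ ≤ C * Real.exp (-((δ - 5 * σ) * (g i).dist y y')) * rateWeight (g i) γ y' :=
          mul_le_mul_of_nonneg_left (hθγ i y') (mul_nonneg hC (Real.exp_nonneg _))
  have hcC : ∀ y y' : (g i).Site, C ≤ (C + 1) * (g i).len y ^ (-p) * (g i).len y' ^ (-((4 : ℕ) : ℝ)) := fun y y' => by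
    rw [hlen i y, hlen i y', Real.one_rpow, Real.one_rpow, mul_one, mul_one]
    linarith
  have hC1 : 0 ≤ C + 1 := by linarith
  have fin := etaRateIneqSite_opGeo_of_hasMaj_rateWeight (B := v1GaugeBg 𝔄 J (s' i) ((g i).eta * ((g i).L ^ nsh i)⁻¹) (g i).M) (d := 4) (p := p)
    (liftBlk (blk i) ι) (blkY i) (hη i) hLpos hC1 hC hcC (vWSiteRelOpsC e g X X' Y q π nsh G D G' D' s s' Wc Wf Fc Fsc Ff Fsf Ws Ws' Ks Ks' i) A' key'
  intro y y'
  exact fin y y'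

end Node

end Summit.QuantumFields.YangMills.BalabanUVNodes.N15.SiteLayer

end
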